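import Literature.NumberTheory.EllipticCurves.PAdicMeasureMoments
import Literature.NumberTheory.EllipticCurves.PAdicLFunctionInvolutionProofs
import HarnessLib

/-!
# The values `L_μ(γ^{±j} − 1) = ∫_{ℤ_p^×} ⟨x⟩^{±j} dμ` of the `p`-adic Mellin transform

`PAdicMeasureMoments` computes the value of the transform `L_μ` of a bounded distribution `μ` on
`ℤ_p` at `T = γ^j − 1` when `τ ∣ j` (then `⟨x⟩^j = x^j` on `ℤ_p^×`).  For the interpolation
property of the Kubota–Leopoldt `p`-adic `L`-function (Lang, *Cyclotomic Fields I and II*, Ch. 4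
§3 Thm. 3.2: `M_p(χE_{1,c})(k) = ∫ ⟨a⟩^{k-1} χ(a) ω(a)⁻¹ dE_{1,c}(a) = ∫ a^{k-1} ω(a)^{-k} χ(a) dE_{1,c}(a)`,
PDF p. 84) one needs every `j`: `⟨x⟩^j = ω(x)^{-j} x^j`, so the level sums at `T = γ^j − 1` are the
Riemann sums of `x^j` against the TWISTED distribution `μ' = ω^{-j} μ`.  This file proves:

* `hasSum_coeff_mul_cyclotomicGenerator_pow_sub_one_of_twist` — if `μ'(η γ^s) η^j = μ(η γ^s)` on
  the classes `η γ^s mod p^{n+e₀}` (`μ' = ω^{-j}μ`) and `ν` is the `j`-th moment distribution of `μ'`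
  (`‖ν(a + p^n) − a^j μ'(a + p^n)‖ ≤ C p^{-n}`), then `L_μ(γ^j − 1) = ν(ℤ_p) − ν(pℤ_p)`;
* `hasSum_coeff_mul_cyclotomicGenerator_inv_pow_sub_one_of_twist` — the same value is taken at
  `T = γ^{-j} − 1` by the transform of the INVERTED distribution `μ̌(u) = μ(u⁻¹)`
  (`∫ ⟨x⟩^{-j} dμ̌ = ∫ ⟨x⟩^{j} dμ`; Lang Ch. 4 §2, **Meas 6**-type change of variables), the form
  in which Greenberg–Vatsal evaluate `L(D, T)` (`L_p(ωχ⁻¹ψ⁻¹, s) = ½ L(D, χ, κ(γ)^s − 1)`, p. 42).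

Everything is proved; there are no named facts.

## References

* S. Lang, *Cyclotomic Fields I and II*, GTM 121, Springer 1990, Ch. 4 §1 (Thm. 1.2, Ex. 2),
  §2 (operations on measures), §3 Thm. 3.2 (PDF pp. 78–84). [LangCyclotomic1990]
* B. Mazur, J. Tate, J. Teitelbaum, Invent. Math. 84 (1986), §I.11, §I.13.
  [MazurTateTeitelbaum1986Invent]
-/

noncomputable section

open Filter Topology

namespace Literature.NumberTheory.EllipticCurves

variable {p : ℕ} [Fact p.Prime]

/-! ### The classes `η γ^s` and their inverses -/

/-- **Inverse class**: `(η γ^s)⁻¹ = η⁻¹ γ^{-s}` modulo `p^{n+e₀}`, i.e. the product of the classes of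
`(η⁻¹, −s)` and `(η, s)` is `1` (`classMap_mul`, `classMap_one`) — the coordinates `x = η γ^s` of
`ℤ_p^× = μ × (1 + p^{e₀}ℤ_p)` are multiplicative (Mazur–Tate–Teitelbaum §I.13; Washington §7.2).
[cite: MazurTateTeitelbaum1986Invent, §I.13 (the coordinates η γ^s on ℤ_p^×)] -/
theorem classMap_inv_mul (n : ℕ) (η : rootsOfUnity (torsionOrder p) ℤ_[p]) (s : ZMod (p ^ n)) :
    PadicInt.toZModPow (n + cyclotomicExponent p) (((η⁻¹ : rootsOfUnity (torsionOrder p) ℤ_[p]) :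
        ℤ_[p]ˣ) : ℤ_[p]) *
        (cyclotomicGenerator p : ZMod (p ^ (n + cyclotomicExponent p))) ^ (-s).val *
      (PadicInt.toZModPow (n + cyclotomicExponent p) ((η : ℤ_[p]ˣ) : ℤ_[p]) *
        (cyclotomicGenerator p : ZMod (p ^ (n + cyclotomicExponent p))) ^ s.val) = 1 := by
  rw [← classMap_mul p n η⁻¹ η (-s) s]
  simp only [inv_mul_cancel, neg_add_cancel]
  exact classMap_one p n

/-! ### The value at `T = γ^j − 1` through the twisted distribution -/

section Direct

variable {μ μ' ν : (n : ℕ) → ZMod (p ^ n) → ℚ_[p]}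

/-- **Level sums at `T = γ^j − 1` as Riemann sums of `x^j` against the twist** (Lang Ch. 4 §3,
proof of Thm. 3.2: `⟨a⟩^{k-1} = a^{k-1}ω(a)^{-(k-1)}`): if `μ'(η γ^s) η^j = μ(η γ^s)` on the classes,
then `∑_{η,s} μ(ηγ^s)(γ^j)^s = ∑_u μ'(u) x_u^j` with the sample points `x_u = η γ^s ∈ ℤ_p`
(`x_u ≡ u`). [cite: LangCyclotomic1990, Ch. 4 §3, proof of Thm. 3.2 (PDF p. 84)] -/
theorem levelSum_cyclotomicGenerator_pow_eq_of_twist {j : ℕ}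
    (htwist : ∀ (n : ℕ) (η : rootsOfUnity (torsionOrder p) ℤ_[p]) (s : ZMod (p ^ n)),
      μ' (n + cyclotomicExponent p)
          (PadicInt.toZModPow (n + cyclotomicExponent p) ((η : ℤ_[p]ˣ) : ℤ_[p]) *
            (cyclotomicGenerator p : ZMod (p ^ (n + cyclotomicExponent p))) ^ s.val) *
          (((η : ℤ_[p]ˣ) : ℤ_[p]) : ℚ_[p]) ^ j =
        μ (n + cyclotomicExponent p)
          (PadicInt.toZModPow (n + cyclotomicExponent p) ((η : ℤ_[p]ˣ) : ℤ_[p]) *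
            (cyclotomicGenerator p : ZMod (p ^ (n + cyclotomicExponent p))) ^ s.val))
    (n : ℕ) :
    ∃ x : ZMod (p ^ (n + cyclotomicExponent p)) → ℤ_[p],
      (∀ a, PadicInt.toZModPow (n + cyclotomicExponent p) (x a) = a) ∧
      ∑ᶠ η : rootsOfUnity (torsionOrder p) ℤ_[p], ∑ s : ZMod (p ^ n),
        μ (n + cyclotomicExponent p)
          (PadicInt.toZModPow (n + cyclotomicExponent p) ((η : ℤ_[p]ˣ) : ℤ_[p]) *
            (cyclotomicGenerator p : ZMod (p ^ (n + cyclotomicExponent p))) ^ s.val) *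
          (1 + (((cyclotomicGenerator p : ℕ) : ℚ_[p]) ^ j - 1)) ^ s.val =
      ∑ u : (ZMod (p ^ (n + cyclotomicExponent p)))ˣ,
        μ' (n + cyclotomicExponent p) u * ((x u : ℤ_[p]) : ℚ_[p]) ^ j := by
  classical
  -- sample points: `x(η γ^s mod p^{n+e₀}) = η γ^s`, anything (say `a.val`) elsewhere
  let pt : rootsOfUnity (torsionOrder p) ℤ_[p] × ZMod (p ^ n) → ℤ_[p] := fun q ↦
    ((q.1 : ℤ_[p]ˣ) : ℤ_[p]) * ((cyclotomicGenerator p : ℕ) : ℤ_[p]) ^ q.2.val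
  let cls : rootsOfUnity (torsionOrder p) ℤ_[p] × ZMod (p ^ n) → ZMod (p ^ (n + cyclotomicExponent p)) :=
    fun q ↦ PadicInt.toZModPow (n + cyclotomicExponent p) ((q.1 : ℤ_[p]ˣ) : ℤ_[p]) *
      (cyclotomicGenerator p : ZMod (p ^ (n + cyclotomicExponent p))) ^ q.2.val
  have hcls : ∀ q, PadicInt.toZModPow (n + cyclotomicExponent p) (pt q) = cls q := fun q ↦ by
    simp [pt, cls, map_mul, map_pow, map_natCast]
  let x : ZMod (p ^ (n + cyclotomicExponent p)) → ℤ_[p] := fun a ↦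
    if h : ∃ q, cls q = a then pt h.choose else (a.val : ℤ_[p])
  have hxcls : ∀ q, x (cls q) = pt q := by
    intro q
    have h : ∃ q', cls q' = cls q := ⟨q, rfl⟩
    simp only [x, dif_pos h]
    have := classMap_injective p n (h.choose_spec)
    exact congrArg pt this
  refine ⟨x, fun a ↦ ?_, ?_⟩
  · by_cases h : ∃ q, cls q = a
    · obtain ⟨q, rfl⟩ := h
      rw [hxcls, hcls]
    · haveI : NeZero (p ^ (n + cyclotomicExponent p)) := ⟨pow_ne_zero _ (Fact.out : p.Prime).ne_zero⟩
      simp only [x, dif_neg h, map_natCast, ZMod.natCast_zmod_val]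
  · rw [← finsum_sum_classes_eq_sum_units p n
      (fun u ↦ μ' (n + cyclotomicExponent p) u * ((x u : ℤ_[p]) : ℚ_[p]) ^ j)]
    refine finsum_congr fun η ↦ Finset.sum_congr rfl fun s _ ↦ ?_
    -- `μ(ηγ^s) γ^{js} = μ'(ηγ^s) (η γ^s)^j` by the twist relation
    have hpt : ((pt (η, s) : ℤ_[p]) : ℚ_[p]) ^ j =
        (((η : ℤ_[p]ˣ) : ℤ_[p]) : ℚ_[p]) ^ j * (((cyclotomicGenerator p : ℕ) : ℚ_[p]) ^ j) ^ s.val := by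
      simp only [pt]
      push_cast
      ring
    change _ = μ' (n + cyclotomicExponent p) (cls (η, s)) * ((x (cls (η, s)) : ℤ_[p]) : ℚ_[p]) ^ j
    rw [hxcls, add_sub_cancel, hpt, ← mul_assoc, htwist n η s]

/-- **`L_μ(γʲ − 1) = ∫_{ℤ_p^×} ⟨x⟩ʲ dμ` for every `j`** (Lang Ch. 4 §3, Thm. 3.2 with §1 Ex. 2:
`∫ u^s dν(u) = f(γ^s − 1)`; Mazur–Tate–Teitelbaum §I.13 with the character `x ↦ ⟨x⟩^j`): let `μ`
be bounded with transform `L` (coefficients = limits of the Riemann sums of `μ`), let `μ'` be the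
twist `ω^{-j}μ` (`μ'(ηγ^s) η^j = μ(ηγ^s)`), bounded by the same `C`, and let `ν` be the `j`-th moment
distribution of `μ'` (distribution relation and `‖ν(a + pⁿ) − (a.val)ʲ μ'(a + pⁿ)‖ ≤ C p⁻ⁿ`).  Then
`∑_k [T^k]L (γʲ − 1)^k = ν(ℤ_p) − ν(pℤ_p)`. [cite: LangCyclotomic1990, Ch. 4 §3, Thm. 3.2 and its proof (PDF p. 84)] -/
theorem hasSum_coeff_mul_cyclotomicGenerator_pow_sub_one_of_twist
    {C : ℝ} (hC : ∀ (n : ℕ) (a : ZMod (p ^ n)), ‖μ n a‖ ≤ C)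
    (hC' : ∀ (n : ℕ) (a : ZMod (p ^ n)), ‖μ' n a‖ ≤ C)
    {L : PowerSeries ℚ_[p]}
    (hL : ∀ k : ℕ, Tendsto (fun n ↦
        ∑ᶠ η : rootsOfUnity (torsionOrder p) ℤ_[p], ∑ s : ZMod (p ^ n),
          μ (n + cyclotomicExponent p)
              (PadicInt.toZModPow (n + cyclotomicExponent p) ((η : ℤ_[p]ˣ) : ℤ_[p]) *
                (cyclotomicGenerator p : ZMod (p ^ (n + cyclotomicExponent p))) ^ s.val) *
            ((s.val.choose k : ℕ) : ℚ_[p])) atTop (𝓝 (PowerSeries.coeff k L)))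
    {j : ℕ}
    (htwist : ∀ (n : ℕ) (η : rootsOfUnity (torsionOrder p) ℤ_[p]) (s : ZMod (p ^ n)),
      μ' (n + cyclotomicExponent p)
          (PadicInt.toZModPow (n + cyclotomicExponent p) ((η : ℤ_[p]ˣ) : ℤ_[p]) *
            (cyclotomicGenerator p : ZMod (p ^ (n + cyclotomicExponent p))) ^ s.val) *
          (((η : ℤ_[p]ˣ) : ℤ_[p]) : ℚ_[p]) ^ j =
        μ (n + cyclotomicExponent p)
          (PadicInt.toZModPow (n + cyclotomicExponent p) ((η : ℤ_[p]ˣ) : ℤ_[p]) *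
            (cyclotomicGenerator p : ZMod (p ^ (n + cyclotomicExponent p))) ^ s.val))
    (hνdist : ∀ (n : ℕ) (a : ZMod (p ^ n)),
      ∑ b ∈ Finset.univ.filter (fun b : ZMod (p ^ (n + 1)) ↦
        ZMod.castHom (pow_dvd_pow p n.le_succ) (ZMod (p ^ n)) b = a), ν (n + 1) b = ν n a)
    (hν : ∀ (n : ℕ) (a : ZMod (p ^ n)),
      ‖ν n a - ((a.val : ℕ) : ℚ_[p]) ^ j * μ' n a‖ ≤ C * (p : ℝ) ^ (-(n : ℤ))) :
    HasSum (fun k : ℕ ↦ PowerSeries.coeff k L * (((cyclotomicGenerator p : ℕ) : ℚ_[p]) ^ j - 1) ^ k)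
      (ν 0 0 - ν 1 0) := by
  choose x hx hsum using fun n ↦ levelSum_cyclotomicGenerator_pow_eq_of_twist (μ := μ) htwist n
  refine hasSum_coeff_mul_pow_of_tendsto_levelSum (μ := μ) (fun _ _ ↦ rfl) hC hL
    (norm_cyclotomicGenerator_pow_sub_one_lt j) ?_
  simp_rw [hsum]
  exact tendsto_sum_units_mul_pow_of_moment j
    (Nat.pos_of_ne_zero (cyclotomicExponent_ne_zero p)) hνdist hC' hν x hx

end Direct

/-! ### The value at `T = γ^{-j} − 1` through the inverted distribution -/

section Inverse

variable {μ μinv μ' ν : (n : ℕ) → ZMod (p ^ n) → ℚ_[p]}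

/-- `‖γ⁻ʲ − 1‖ < 1` in `ℚ_p` for the topological generator `γ = 1 + p^{e₀}` of `1 + p^{e₀}ℤ_p`
(so that a power series in `Λ` may be evaluated at `T = γ^{-j} − 1`; Lang Ch. 4 §1 Ex. 2,
`f(γ^s − 1)` for `s ∈ ℤ_p`). [cite: LangCyclotomic1990, Ch. 4 §1, Example 2 (PDF p. 79)] -/
theorem norm_cyclotomicGenerator_inv_pow_sub_one_lt (j : ℕ) :
    ‖(((cyclotomicGenerator p : ℕ) : ℚ_[p])⁻¹) ^ j - 1‖ < 1 := by
  have hγ0 : ((cyclotomicGenerator p : ℕ) : ℚ_[p]) ^ j ≠ 0 := by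
    refine pow_ne_zero _ ?_
    exact_mod_cast (show cyclotomicGenerator p ≠ 0 by unfold cyclotomicGenerator; omega)
  have hγ1 : ‖((cyclotomicGenerator p : ℕ) : ℚ_[p]) ^ j‖ = 1 := by
    have h := norm_cyclotomicGenerator_pow_sub_one_lt (p := p) j
    have e : ((cyclotomicGenerator p : ℕ) : ℚ_[p]) ^ j =
        (((cyclotomicGenerator p : ℕ) : ℚ_[p]) ^ j - 1) + 1 := by ring
    rw [e, IsUltrametricDist.norm_add_eq_max_of_norm_ne_norm (by rw [norm_one]; exact h.ne),
      norm_one]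
    exact max_eq_right h.le
  have e : (((cyclotomicGenerator p : ℕ) : ℚ_[p])⁻¹) ^ j - 1 =
      -((((cyclotomicGenerator p : ℕ) : ℚ_[p]) ^ j)⁻¹ *
        (((cyclotomicGenerator p : ℕ) : ℚ_[p]) ^ j - 1)) := by
    rw [inv_pow]; field_simp; ring
  rw [e, norm_neg, norm_mul, norm_inv, hγ1, inv_one, one_mul]
  exact norm_cyclotomicGenerator_pow_sub_one_lt j

/-- **Level sums of the inverted distribution at `T = γ^{-j} − 1`** (change of variables
`x ↦ x⁻¹` on `ℤ_p^×`): if `μ̌(ηγ^s) = μ(η⁻¹γ^{-s})` and `μ'(ηγ^s)η^j = μ(ηγ^s)`, then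
`∑_{η,s} μ̌(ηγ^s)(γ^{-j})^s = ∑_u μ'(u) y_u^j` with the sample points `y_{u} = η⁻¹ γ^{-s} ∈ ℤ_p`
at `u = (ηγ^s)⁻¹` (`y_u ≡ u`). [cite: LangCyclotomic1990, Ch. 4 §2–§3 (operations on measures; proof of Thm. 3.2) (PDF pp. 80–84)] -/
theorem levelSum_cyclotomicGenerator_inv_pow_eq_of_twist {j : ℕ}
    (hinv : ∀ (n : ℕ) (η : rootsOfUnity (torsionOrder p) ℤ_[p]) (s : ZMod (p ^ n)),
      μinv (n + cyclotomicExponent p)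
          (PadicInt.toZModPow (n + cyclotomicExponent p) ((η : ℤ_[p]ˣ) : ℤ_[p]) *
            (cyclotomicGenerator p : ZMod (p ^ (n + cyclotomicExponent p))) ^ s.val) =
        μ (n + cyclotomicExponent p)
          (PadicInt.toZModPow (n + cyclotomicExponent p)
              (((η⁻¹ : rootsOfUnity (torsionOrder p) ℤ_[p]) : ℤ_[p]ˣ) : ℤ_[p]) *
            (cyclotomicGenerator p : ZMod (p ^ (n + cyclotomicExponent p))) ^ (-s).val))
    (htwist : ∀ (n : ℕ) (η : rootsOfUnity (torsionOrder p) ℤ_[p]) (s : ZMod (p ^ n)),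
      μ' (n + cyclotomicExponent p)
          (PadicInt.toZModPow (n + cyclotomicExponent p) ((η : ℤ_[p]ˣ) : ℤ_[p]) *
            (cyclotomicGenerator p : ZMod (p ^ (n + cyclotomicExponent p))) ^ s.val) *
          (((η : ℤ_[p]ˣ) : ℤ_[p]) : ℚ_[p]) ^ j =
        μ (n + cyclotomicExponent p)
          (PadicInt.toZModPow (n + cyclotomicExponent p) ((η : ℤ_[p]ˣ) : ℤ_[p]) *
            (cyclotomicGenerator p : ZMod (p ^ (n + cyclotomicExponent p))) ^ s.val))
    (n : ℕ) :
    ∃ y : ZMod (p ^ (n + cyclotomicExponent p)) → ℤ_[p],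
      (∀ a, PadicInt.toZModPow (n + cyclotomicExponent p) (y a) = a) ∧
      ∑ᶠ η : rootsOfUnity (torsionOrder p) ℤ_[p], ∑ s : ZMod (p ^ n),
        μinv (n + cyclotomicExponent p)
          (PadicInt.toZModPow (n + cyclotomicExponent p) ((η : ℤ_[p]ˣ) : ℤ_[p]) *
            (cyclotomicGenerator p : ZMod (p ^ (n + cyclotomicExponent p))) ^ s.val) *
          (1 + ((((cyclotomicGenerator p : ℕ) : ℚ_[p])⁻¹) ^ j - 1)) ^ s.val =
      ∑ u : (ZMod (p ^ (n + cyclotomicExponent p)))ˣ,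
        μ' (n + cyclotomicExponent p) u * ((y u : ℤ_[p]) : ℚ_[p]) ^ j := by
  classical
  haveI := neZero_torsionOrder p
  haveI := Fintype.ofFinite (rootsOfUnity (torsionOrder p) ℤ_[p])
  haveI : NeZero (p ^ (n + cyclotomicExponent p)) := ⟨pow_ne_zero _ (Fact.out : p.Prime).ne_zero⟩
  set L := n + cyclotomicExponent p with hLdef
  -- the classes and the "direct" sample points, as in the direct case
  let cls : rootsOfUnity (torsionOrder p) ℤ_[p] × ZMod (p ^ n) → ZMod (p ^ L) :=
    fun q ↦ PadicInt.toZModPow L ((q.1 : ℤ_[p]ˣ) : ℤ_[p]) * (cyclotomicGenerator p : ZMod (p ^ L)) ^ q.2.val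
  let pt : rootsOfUnity (torsionOrder p) ℤ_[p] × ZMod (p ^ n) → ℤ_[p] := fun q ↦
    ((q.1 : ℤ_[p]ˣ) : ℤ_[p]) * ((cyclotomicGenerator p : ℕ) : ℤ_[p]) ^ q.2.val
  have hcls : ∀ q, PadicInt.toZModPow L (pt q) = cls q := fun q ↦ by
    simp [pt, cls, map_mul, map_pow, map_natCast]
  let x : ZMod (p ^ L) → ℤ_[p] := fun a ↦
    if h : ∃ q, cls q = a then pt h.choose else (a.val : ℤ_[p])
  have hxcls : ∀ q, x (cls q) = pt q := by
    intro q
    have h : ∃ q', cls q' = cls q := ⟨q, rfl⟩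
    simp only [x, dif_pos h]
    exact congrArg pt (classMap_injective p n h.choose_spec)
  have hx : ∀ a, PadicInt.toZModPow L (x a) = a := by
    intro a
    by_cases h : ∃ q, cls q = a
    · obtain ⟨q, rfl⟩ := h
      rw [hxcls, hcls]
    · simp only [x, dif_neg h, map_natCast, ZMod.natCast_zmod_val]
  -- `γ` is a unit of `ℤ_p`; the inverted sample points `y u = (x u⁻¹)⁻¹`-like: we take
  -- `y u := η⁻¹ γ_unit^{-s}` at `u⁻¹ = cls (η, s)`, realised as `x(u⁻¹)` inverted in `ℤ_p^×`.
  have hγunit : IsUnit ((cyclotomicGenerator p : ℕ) : ℤ_[p]) := by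
    rw [PadicInt.isUnit_iff]
    have h1 : ‖((cyclotomicGenerator p : ℕ) : ℤ_[p]) - 1‖ < 1 := by
      rw [cyclotomicGenerator]; push_cast
      rw [add_sub_cancel_left, norm_pow, PadicInt.norm_p]
      exact pow_lt_one₀ (by positivity)
        (inv_lt_one_of_one_lt₀ (by exact_mod_cast (Fact.out : p.Prime).one_lt))
        (cyclotomicExponent_ne_zero p)
    have e : ((cyclotomicGenerator p : ℕ) : ℤ_[p]) = (((cyclotomicGenerator p : ℕ) : ℤ_[p]) - 1) + 1 := by
      ring
    rw [e, PadicInt.norm_add_eq_max_of_ne (by rw [norm_one]; exact h1.ne), norm_one]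
    exact max_eq_right h1.le
  have hptunit : ∀ q, IsUnit (pt q) := fun q ↦ ((q.1 : ℤ_[p]ˣ).isUnit).mul (hγunit.pow _)
  -- `y u := (x (u⁻¹))⁻¹` computed in `ℤ_p^×` when `x (u⁻¹)` is a unit (it always is on classes)
  let y : ZMod (p ^ L) → ℤ_[p] := fun a ↦
    if h : IsUnit a ∧ IsUnit (x (a⁻¹)) then ((h.2.unit⁻¹ : ℤ_[p]ˣ) : ℤ_[p]) else (a.val : ℤ_[p])
  have hy : ∀ a, PadicInt.toZModPow L (y a) = a := by
    intro a
    by_cases h : IsUnit a ∧ IsUnit (x (a⁻¹))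
    · simp only [y, dif_pos h]
      have h1 : PadicInt.toZModPow L ((h.2.unit : ℤ_[p]ˣ) : ℤ_[p]) = a⁻¹ := by
        rw [IsUnit.unit_spec, hx]
      have h2 : PadicInt.toZModPow L ((h.2.unit⁻¹ : ℤ_[p]ˣ) : ℤ_[p]) *
          PadicInt.toZModPow L ((h.2.unit : ℤ_[p]ˣ) : ℤ_[p]) = 1 := by
        rw [← map_mul, Units.inv_mul, map_one]
      rw [h1] at h2
      calc PadicInt.toZModPow L ((h.2.unit⁻¹ : ℤ_[p]ˣ) : ℤ_[p])
          = PadicInt.toZModPow L ((h.2.unit⁻¹ : ℤ_[p]ˣ) : ℤ_[p]) * (a⁻¹ * a) := by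
            rw [ZMod.inv_mul_of_unit a h.1, mul_one]
        _ = a := by rw [← mul_assoc, h2, one_mul]
    · simp only [y, dif_neg h, map_natCast, ZMod.natCast_zmod_val]
  refine ⟨y, hy, ?_⟩
  -- reindex the right-hand side along `u ↦ u⁻¹`, then along the classes
  have hreindex : ∑ u : (ZMod (p ^ L))ˣ, μ' L (u : ZMod (p ^ L))⁻¹ *
        ((y (u : ZMod (p ^ L))⁻¹ : ℤ_[p]) : ℚ_[p]) ^ j =
      ∑ u : (ZMod (p ^ L))ˣ, μ' L u * ((y u : ℤ_[p]) : ℚ_[p]) ^ j :=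
    Fintype.sum_equiv (Equiv.inv (ZMod (p ^ L))ˣ) _ _ fun u ↦ by
      simp only [Equiv.inv_apply, ZMod.inv_coe_unit]
  rw [← hreindex, ← finsum_sum_classes_eq_sum_units p n
    (fun a ↦ μ' L a⁻¹ * ((y a⁻¹ : ℤ_[p]) : ℚ_[p]) ^ j)]
  · refine finsum_congr fun η ↦ Finset.sum_congr rfl fun s _ ↦ ?_
    -- the class `u = cls (η, s)`, its inverse `cls (η⁻¹, -s)`
    have h1 := classMap_inv_mul (p := p) n η s
    change cls (η⁻¹, -s) * cls (η, s) = 1 at h1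
    have hucls : (cls (η, s))⁻¹ = cls (η⁻¹, -s) :=
      ZMod.inv_eq_of_mul_eq_one _ _ _ (by rw [mul_comm]; exact h1)
    change μinv L (cls (η, s)) * _ = μ' L (cls (η, s))⁻¹ * ((y (cls (η, s))⁻¹ : ℤ_[p]) : ℚ_[p]) ^ j
    rw [hucls]
    -- `y (cls(η⁻¹,-s)) = (x (cls(η⁻¹,-s)⁻¹))⁻¹ = (x (cls (η,s)))⁻¹ = (η γ^s)⁻¹`
    have hinv2 : (cls (η⁻¹, -s))⁻¹ = cls (η, s) := ZMod.inv_eq_of_mul_eq_one _ _ _ h1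
    have hxu : x ((cls (η⁻¹, -s))⁻¹) = pt (η, s) := by rw [hinv2, hxcls]
    have hcond : IsUnit (cls (η⁻¹, -s)) ∧ IsUnit (x ((cls (η⁻¹, -s))⁻¹)) :=
      ⟨isUnit_classMap p n (η⁻¹, -s), hxu ▸ hptunit (η, s)⟩
    have hyval : ((y (cls (η⁻¹, -s)) : ℤ_[p]) : ℚ_[p]) * ((pt (η, s) : ℤ_[p]) : ℚ_[p]) = 1 := by
      simp only [y, dif_pos hcond]
      rw [← PadicInt.coe_mul, ← hxu, IsUnit.val_inv_mul, PadicInt.coe_one]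
    -- compute both sides
    rw [hinv n η s, add_sub_cancel]
    have hγ0 : (((cyclotomicGenerator p : ℕ) : ℚ_[p])) ≠ 0 := by
      exact_mod_cast (show cyclotomicGenerator p ≠ 0 by unfold cyclotomicGenerator; omega)
    have hη0 : (((η : ℤ_[p]ˣ) : ℤ_[p]) : ℚ_[p]) ≠ 0 := by
      rw [ne_eq, PadicInt.coe_eq_zero]
      exact (η : ℤ_[p]ˣ).ne_zero
    have hpt : ((pt (η, s) : ℤ_[p]) : ℚ_[p]) =
        (((η : ℤ_[p]ˣ) : ℤ_[p]) : ℚ_[p]) * ((cyclotomicGenerator p : ℕ) : ℚ_[p]) ^ s.val := by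
      simp only [pt]; push_cast; ring
    have hyeq : ((y (cls (η⁻¹, -s)) : ℤ_[p]) : ℚ_[p]) =
        ((((η : ℤ_[p]ˣ) : ℤ_[p]) : ℚ_[p]) * ((cyclotomicGenerator p : ℕ) : ℚ_[p]) ^ s.val)⁻¹ := by
      rw [← hpt]
      exact eq_inv_of_mul_eq_one_left hyval
    rw [hyeq, ← htwist n η⁻¹ (-s)]
    have hηinv : ((((η⁻¹ : rootsOfUnity (torsionOrder p) ℤ_[p]) : ℤ_[p]ˣ) : ℤ_[p]) : ℚ_[p]) =
        ((((η : ℤ_[p]ˣ) : ℤ_[p]) : ℚ_[p]))⁻¹ := by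
      rw [Subgroup.coe_inv]
      exact eq_inv_of_mul_eq_one_left (by rw [← PadicInt.coe_mul, Units.inv_mul, PadicInt.coe_one])
    rw [hηinv]
    have hAB : μ' L (cls (η⁻¹, -s)) = μ' (n + cyclotomicExponent p)
        (PadicInt.toZModPow (n + cyclotomicExponent p)
            (((η⁻¹ : rootsOfUnity (torsionOrder p) ℤ_[p]) : ℤ_[p]ˣ) : ℤ_[p]) *
          (cyclotomicGenerator p : ZMod (p ^ (n + cyclotomicExponent p))) ^ (-s).val) := rfl
    rw [hAB]
    ring

/-- **`L_{μ̌}(γ^{-j} − 1) = ∫_{ℤ_p^×} ⟨x⟩ʲ dμ`**: the transform of the inverted distribution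
`μ̌(u) = μ(u⁻¹)` takes at `T = γ^{-j} − 1` the same value `ν(ℤ_p) − ν(pℤ_p)` as `L_μ` at
`T = γ^{j} − 1` (`ν` the `j`-th moment distribution of the twist `μ' = ω^{-j}μ`) — the form in
which a Kubota–Leopoldt function is evaluated at `κ(γ)^{s} − 1` rather than `κ(γ)^{-s} − 1`
(Greenberg–Vatsal p. 42 for `L(D, T)`; Lang Ch. 4 §§2–3).
[cite: LangCyclotomic1990, Ch. 4 §2–§3, operations on measures and Thm. 3.2 (PDF pp. 80–84)] -/
theorem hasSum_coeff_mul_cyclotomicGenerator_inv_pow_sub_one_of_twist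
    {C : ℝ} (hC : ∀ (n : ℕ) (a : ZMod (p ^ n)), ‖μinv n a‖ ≤ C)
    (hC' : ∀ (n : ℕ) (a : ZMod (p ^ n)), ‖μ' n a‖ ≤ C)
    {L : PowerSeries ℚ_[p]}
    (hL : ∀ k : ℕ, Tendsto (fun n ↦
        ∑ᶠ η : rootsOfUnity (torsionOrder p) ℤ_[p], ∑ s : ZMod (p ^ n),
          μinv (n + cyclotomicExponent p)
              (PadicInt.toZModPow (n + cyclotomicExponent p) ((η : ℤ_[p]ˣ) : ℤ_[p]) *
                (cyclotomicGenerator p : ZMod (p ^ (n + cyclotomicExponent p))) ^ s.val) *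
            ((s.val.choose k : ℕ) : ℚ_[p])) atTop (𝓝 (PowerSeries.coeff k L)))
    {j : ℕ}
    (hinv : ∀ (n : ℕ) (η : rootsOfUnity (torsionOrder p) ℤ_[p]) (s : ZMod (p ^ n)),
      μinv (n + cyclotomicExponent p)
          (PadicInt.toZModPow (n + cyclotomicExponent p) ((η : ℤ_[p]ˣ) : ℤ_[p]) *
            (cyclotomicGenerator p : ZMod (p ^ (n + cyclotomicExponent p))) ^ s.val) =
        μ (n + cyclotomicExponent p)
          (PadicInt.toZModPow (n + cyclotomicExponent p)
              (((η⁻¹ : rootsOfUnity (torsionOrder p) ℤ_[p]) : ℤ_[p]ˣ) : ℤ_[p]) *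
            (cyclotomicGenerator p : ZMod (p ^ (n + cyclotomicExponent p))) ^ (-s).val))
    (htwist : ∀ (n : ℕ) (η : rootsOfUnity (torsionOrder p) ℤ_[p]) (s : ZMod (p ^ n)),
      μ' (n + cyclotomicExponent p)
          (PadicInt.toZModPow (n + cyclotomicExponent p) ((η : ℤ_[p]ˣ) : ℤ_[p]) *
            (cyclotomicGenerator p : ZMod (p ^ (n + cyclotomicExponent p))) ^ s.val) *
          (((η : ℤ_[p]ˣ) : ℤ_[p]) : ℚ_[p]) ^ j =
        μ (n + cyclotomicExponent p)
          (PadicInt.toZModPow (n + cyclotomicExponent p) ((η : ℤ_[p]ˣ) : ℤ_[p]) *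
            (cyclotomicGenerator p : ZMod (p ^ (n + cyclotomicExponent p))) ^ s.val))
    (hνdist : ∀ (n : ℕ) (a : ZMod (p ^ n)),
      ∑ b ∈ Finset.univ.filter (fun b : ZMod (p ^ (n + 1)) ↦
        ZMod.castHom (pow_dvd_pow p n.le_succ) (ZMod (p ^ n)) b = a), ν (n + 1) b = ν n a)
    (hν : ∀ (n : ℕ) (a : ZMod (p ^ n)),
      ‖ν n a - ((a.val : ℕ) : ℚ_[p]) ^ j * μ' n a‖ ≤ C * (p : ℝ) ^ (-(n : ℤ))) :
    HasSum (fun k : ℕ ↦ PowerSeries.coeff k L *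
        ((((cyclotomicGenerator p : ℕ) : ℚ_[p])⁻¹) ^ j - 1) ^ k) (ν 0 0 - ν 1 0) := by
  choose y hy hsum using
    fun n ↦ levelSum_cyclotomicGenerator_inv_pow_eq_of_twist (μ := μ) (μinv := μinv) hinv htwist n
  refine hasSum_coeff_mul_pow_of_tendsto_levelSum (μ := μinv) (fun _ _ ↦ rfl) hC hL
    (norm_cyclotomicGenerator_inv_pow_sub_one_lt j) ?_
  simp_rw [hsum]
  exact tendsto_sum_units_mul_pow_of_moment j
    (Nat.pos_of_ne_zero (cyclotomicExponent_ne_zero p)) hνdist hC' hν y hy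

end Inverse

end Literature.NumberTheory.EllipticCurves

end
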